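import Summits.RiemannHypothesis.RiemannHypothesis.Theorems.PfPersistenceM2DilationStability
import Literature.NumberTheory.LFunctions.WeilDilationVirialDeriv
import Literature.NumberTheory.LFunctions.WeilWindowSimpleEven
import Literature.NumberTheory.LFunctions.WeilMellinBounds
import Literature.NumberTheory.LFunctions.WeilMellinInversion
import HarnessLib

/-!
# HANDOFF — pole-free closedness, part 1/2: the sesquilinear pairing under Bombieri's dilation, and a positive bump
# (cell rh-explicit, TRACK «HANDOFF», seat theory-1, file XV-a)

HONEST FRAMING. Nothing here bears on the truth of RH. Unconditional bookkeeping on Weil's quadratic form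
`Q(g) = W(g ⋆ g̃)` (`WeilExplicit.lean`) used by part 2/2 (`HandoffPoleFreeClosed.lean`: the POLE-FREE positive windows are
CLOSED, hence Connes–Consani's Conj. 4.1 at `q` ⟺ Connes's `P(q)`):

* §1 the cross-correlation of two dilates is the rescaled cross-correlation `(u_η ⋆ ṽ_η)(t) = (u ⋆ ṽ)((1+η)t)` (the tree has the
  case `u = v`); `Q(u₀ + a₁u₁ + a₂u₂)` is the nine-term expansion (sesquilinearity of the pairing `W(u ⋆ ṽ)` and linearity of the
  dilation are the tree's, `PfPersistenceM2DilationStability.lean` / `SoloInformedGroundStateEquation.lean`, reused by name).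
* §2 `η ↦ W(u_η ⋆ ṽ_η)` is continuous at `η = 0` (tree: `hasDerivAt_weilFunctional_comp_mul`, the rescaling variation), and so is
  `η ↦ ĝ(½ + (s−½)/(1+η))` (`ĝ` is entire).
* §3 for every `a > 0` a non-negative bump `φ ∈ C(a)` with `Re φ̂(σ) > 0` at every REAL `σ` (Mathlib's `ContDiffBump`; the tree's
  `exists_isWeilTest_re_weilMellin_pos` is the same bump without the support bound).

References: E. Bombieri, Rend. Lincei (9) 11 (2000) §3–§4 [`Bombieri2000Weil`]; H. Yoshida, Adv. Stud. Pure Math. 21 (1992) Lemma 7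
[`Yoshida1992HermitianForms`].
-/

set_option linter.dupNamespace false  -- the mandated namespace repeats `RiemannHypothesis`

noncomputable section

open Set Filter Complex MeasureTheory Literature.NumberTheory.LFunctions
open Summit.RiemannHypothesis.RiemannHypothesis.Theorems.PfPersistenceM2NegIndex
open scoped Topology ComplexConjugate

namespace Summit.RiemannHypothesis.RiemannHypothesis.Theorems.HandoffPoleFree

variable {u u' v v' g : ℝ → ℂ} {a η : ℝ}

/-! ## §1  Algebra: dilation is linear, the sesquilinear pairing `W(u ⋆ ṽ)` -/

/-- Bombieri's dilation commutes with scalars. [folklore] -/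
theorem weilDilate_const_mul (η : ℝ) (c : ℂ) (u : ℝ → ℂ) :
    weilDilate η (fun t ↦ c * u t) = fun t ↦ c * weilDilate η u t := by
  funext t
  simp only [weilDilate_apply]
  ring

/-- **The cross-correlation of two dilates is the rescaled cross-correlation**: `(u_η ⋆ ṽ_η)(t) = (u ⋆ ṽ)((1+η)t)`
for `η > −1` (substitute `y = (1+η)x`; the factor `(1+η)^{1/2}·(1+η)^{1/2}` cancels the Jacobian). The case
`u = v` is the tree's `weilConv_weilDilate_weilReflect`. [cite: Bombieri2000Weil, §4 proof of Thm 5 (the dilation)] -/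
theorem weilConv_weilDilate_weilReflect_weilDilate (u v : ℝ → ℂ) (hη : -1 < η) :
    weilConv (weilDilate η u) (weilReflect (weilDilate η v)) =
      fun t ↦ weilConv u (weilReflect v) ((1 + η) * t) := by
  have hc : 0 < 1 + η := by linarith
  funext t
  rw [weilConv_apply, weilConv_apply]
  set G : ℝ → ℂ := fun y ↦ u y * weilReflect v ((1 + η) * t - y) with hG
  have h2 : ((Real.sqrt (1 + η) : ℝ) : ℂ) * (Real.sqrt (1 + η) : ℂ) = ((1 + η : ℝ) : ℂ) := by
    rw [← Complex.ofReal_mul, Real.mul_self_sqrt hc.le]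
  have e : (fun x : ℝ ↦ weilDilate η u x * weilReflect (weilDilate η v) (t - x)) =
      fun x ↦ ((1 + η : ℝ) : ℂ) * G ((1 + η) * x) := by
    funext x
    simp only [hG, weilDilate, weilReflect, map_mul, Complex.conj_ofReal]
    have h3 : (1 + η) * -(t - x) = -((1 + η) * t - (1 + η) * x) := by ring
    rw [h3]
    linear_combination (u ((1 + η) * x) * conj (v (-((1 + η) * t - (1 + η) * x)))) * h2
  rw [e, integral_const_mul, Measure.integral_comp_mul_left G (1 + η), Complex.real_smul,
    abs_of_pos (inv_pos.2 hc), ← mul_assoc, ← Complex.ofReal_mul, mul_inv_cancel₀ hc.ne',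
    Complex.ofReal_one, one_mul]

/-- **Sesquilinear expansion of `Q` over a three-term combination** `u₀ + a₁ u₁ + a₂ u₂` (test functions): the nine
pairings. [cite: Bombieri2000Weil, §3 (T[f * f̄*] is a hermitian form)] -/
theorem weilQuadratic_add_three {u₀ u₁ u₂ : ℝ → ℂ} (h₀ : IsWeilTest u₀) (h₁ : IsWeilTest u₁) (h₂ : IsWeilTest u₂)
    (a₁ a₂ : ℂ) :
    weilQuadratic (u₀ + (fun t ↦ a₁ * u₁ t) + fun t ↦ a₂ * u₂ t) =
      weilFunctional (weilConv u₀ (weilReflect u₀))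
      + conj a₁ * weilFunctional (weilConv u₀ (weilReflect u₁)) + conj a₂ * weilFunctional (weilConv u₀ (weilReflect u₂))
      + a₁ * weilFunctional (weilConv u₁ (weilReflect u₀)) + a₂ * weilFunctional (weilConv u₂ (weilReflect u₀))
      + a₁ * conj a₁ * weilFunctional (weilConv u₁ (weilReflect u₁))
      + a₁ * conj a₂ * weilFunctional (weilConv u₁ (weilReflect u₂))
      + a₂ * conj a₁ * weilFunctional (weilConv u₂ (weilReflect u₁))
      + a₂ * conj a₂ * weilFunctional (weilConv u₂ (weilReflect u₂)) := by
  have h₁' : IsWeilTest (fun t ↦ a₁ * u₁ t) := h₁.const_mul a₁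
  have h₂' : IsWeilTest (fun t ↦ a₂ * u₂ t) := h₂.const_mul a₂
  have h01 : IsWeilTest (u₀ + fun t ↦ a₁ * u₁ t) := h₀.add h₁'
  unfold weilQuadratic
  rw [weilFunctional_weilConv_weilReflect_add_left h01 h₂' (h01.add h₂'),
    weilFunctional_weilConv_weilReflect_add_right h01 h01 h₂', weilFunctional_weilConv_weilReflect_add_right h₂' h01 h₂',
    weilFunctional_weilConv_weilReflect_add_left h₀ h₁' h01, weilFunctional_weilConv_weilReflect_add_right h₀ h₀ h₁',
    weilFunctional_weilConv_weilReflect_add_right h₁' h₀ h₁',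
    weilFunctional_weilConv_weilReflect_add_left h₀ h₁' h₂', weilFunctional_weilConv_weilReflect_add_right h₂' h₀ h₁']
  simp only [weilFunctional_weilConv_weilReflect_const_mul_left, weilCross_const_mul_right]
  ring

/-! ## §2  Continuity along the dilation -/

/-- `c ↦ W(k(c·))` is continuous at every `c₀ > 0` for a test kernel `k` (it is differentiable there:
`hasDerivAt_weilFunctional_comp_mul`). [folklore] -/
theorem continuousAt_weilFunctional_comp_mul {k : ℝ → ℂ} (hk : IsWeilTest k) {c₀ : ℝ} (hc₀ : 0 < c₀) :
    ContinuousAt (fun c : ℝ ↦ weilFunctional (fun t ↦ k (c * t))) c₀ :=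
  (hasDerivAt_weilFunctional_comp_mul hk hc₀).continuousAt

/-- **The pairing of two dilates is continuous in `η` at `0`**: `η ↦ W(u_η ⋆ ṽ_η) = W((u ⋆ ṽ)((1+η)·))`. [folklore] -/
theorem continuousAt_pairing_weilDilate (hu : IsWeilTest u) (hv : IsWeilTest v) :
    ContinuousAt (fun η : ℝ ↦ weilFunctional (weilConv (weilDilate η u) (weilReflect (weilDilate η v)))) 0 := by
  set k : ℝ → ℂ := weilConv u (weilReflect v) with hk_def
  have hk : IsWeilTest k := hu.weilConv hv.weilReflect
  have heq : (fun η : ℝ ↦ weilFunctional (weilConv (weilDilate η u) (weilReflect (weilDilate η v)))) =ᶠ[𝓝 0]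
      fun η ↦ weilFunctional (fun t ↦ k ((1 + η) * t)) := by
    filter_upwards [Ioi_mem_nhds (show (-1 : ℝ) < 0 by norm_num)] with η hη
    rw [weilConv_weilDilate_weilReflect_weilDilate u v hη]
  refine (ContinuousAt.congr ?_ heq.symm)
  have h1 : ContinuousAt (fun η : ℝ ↦ 1 + η) 0 := (continuous_const.add continuous_id).continuousAt
  have h2 : ContinuousAt (fun c : ℝ ↦ weilFunctional (fun t ↦ k (c * t))) (1 + 0) :=
    continuousAt_weilFunctional_comp_mul hk (by norm_num)
  exact ContinuousAt.comp (g := fun c : ℝ ↦ weilFunctional (fun t ↦ k (c * t))) h2 h1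

/-- The moving Mellin argument `η ↦ ½ + (s − ½)/(1+η)` is continuous at `η = 0`. [folklore] -/
theorem continuousAt_dilateArg (s : ℂ) :
    ContinuousAt (fun η : ℝ ↦ (1 / 2 : ℂ) + (s - 1 / 2) / ((1 + η : ℝ) : ℂ)) 0 := by
  have h1 : ContinuousAt (fun η : ℝ ↦ ((1 + η : ℝ) : ℂ)) 0 :=
    (Complex.continuous_ofReal.comp (continuous_const.add continuous_id)).continuousAt
  have h2 : ((1 + (0 : ℝ) : ℝ) : ℂ) ≠ 0 := by norm_num
  exact continuousAt_const.add (continuousAt_const.div h1 h2)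

/-- `η ↦ ĝ(½ + (s − ½)/(1+η))` is continuous at `η = 0` for a test function `g` (`ĝ` is entire). [folklore] -/
theorem continuousAt_weilMellin_dilateArg (hg : IsWeilTest g) (s : ℂ) :
    ContinuousAt (fun η : ℝ ↦ weilMellin g ((1 / 2 : ℂ) + (s - 1 / 2) / ((1 + η : ℝ) : ℂ))) 0 :=
  ContinuousAt.comp (g := weilMellin g)
    (continuous_weilMellin hg.1.continuous hg.2).continuousAt (continuousAt_dilateArg s)

/-! ## §3  A bump in the window whose transform is positive on the real axis -/

/-- For every `a > 0` there is a test function `φ` supported in `[−a, a]` (a non-negative bump at `0`) with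
`Re φ̂(σ) > 0` for every REAL `σ` (the integrand `φ(t) e^{(σ−½)t}` is `≥ 0` and positive at `t = 0`). [folklore] -/
theorem exists_isWeilTest_tsupport_subset_re_weilMellin_pos (ha : 0 < a) :
    ∃ φ : ℝ → ℂ, IsWeilTest φ ∧ tsupport φ ⊆ Icc (-a) a ∧ ∀ σ : ℝ, 0 < (weilMellin φ (σ : ℂ)).re := by
  let b : ContDiffBump (0 : ℝ) := ⟨a / 2, a, by positivity, by linarith⟩
  refine ⟨fun t ↦ ((b t : ℝ) : ℂ), ⟨?_, ?_⟩, ?_, fun σ ↦ ?_⟩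
  · exact Complex.ofRealCLM.contDiff.comp b.contDiff
  · exact b.hasCompactSupport.comp_left Complex.ofReal_zero
  · -- support of the bump is the ball of radius `a`
    have hs : Function.support (fun t ↦ ((b t : ℝ) : ℂ)) ⊆ Metric.closedBall (0 : ℝ) a := by
      intro t ht
      have ht' : t ∈ Function.support (b : ℝ → ℝ) := by
        simpa [Function.mem_support, Complex.ofReal_eq_zero] using ht
      rw [b.support_eq] at ht'
      exact Metric.ball_subset_closedBall ht'
    have h2 : tsupport (fun t ↦ ((b t : ℝ) : ℂ)) ⊆ Metric.closedBall (0 : ℝ) a :=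
      closure_minimal hs Metric.isClosed_closedBall
    rw [Real.closedBall_eq_Icc, zero_sub, zero_add] at h2
    exact h2
  · set F : ℝ → ℝ := fun t ↦ b t * Real.exp ((σ - 1 / 2) * t) with hF
    have hint : Integrable fun t : ℝ ↦ ((b t : ℝ) : ℂ) * cexp (((σ : ℂ) - 1 / 2) * t) :=
      integrable_weilIntegrand (Complex.continuous_ofReal.comp b.continuous)
        (b.hasCompactSupport.comp_left Complex.ofReal_zero) _
    have hre : ∀ t : ℝ, (((b t : ℝ) : ℂ) * cexp (((σ : ℂ) - 1 / 2) * t)).re = F t := by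
      intro t
      rw [Complex.re_ofReal_mul, Complex.exp_re]
      have h1 : (((σ : ℂ) - 1 / 2) * (t : ℂ)).re = (σ - 1 / 2) * t := by
        simp [sub_re, mul_re]
      have h2 : (((σ : ℂ) - 1 / 2) * (t : ℂ)).im = 0 := by
        simp [sub_im, mul_im]
      rw [h1, h2, hF, Real.cos_zero, mul_one]
    unfold weilMellin
    have hI := integral_re hint
    simp only [RCLike.re_to_complex] at hI
    beta_reduce
    rw [← hI]
    simp_rw [hre]
    have hFc : Continuous F := by
      simp only [hF]
      have hb := b.continuous
      fun_prop
    have hFsupp : HasCompactSupport F := by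
      simp only [hF]
      exact b.hasCompactSupport.mul_right
    have hFnn : 0 ≤ F := fun t ↦ mul_nonneg (b.nonneg' t) (Real.exp_pos _).le
    have hF0 : F 0 ≠ 0 := by
      have hb0 : b 0 = 1 := b.one_of_mem_closedBall (by simp [b]; positivity)
      simp [hF, hb0]
    exact hFc.integral_pos_of_hasCompactSupport_nonneg_nonzero hFsupp hFnn hF0

/-! ## §4  Appendix (APPEND REMEDY, lead ruling R14-3, 2026-08-24): one pure-proof corollary; all declarations above byte-identical

Build note: this module was ACCEPTED (p366699, commit 3571d1351893, 2026-08-23 ≈ 14:35Z) but never received a hub olean in the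
08-23 build backlog (OPS-REQUESTS l.199/l.208), which kept its dependent `HandoffPoleFreeClosed.lean` (p367042) gate-deferred
(«no-olean»). Re-filing it as an append triggers its build; nothing above is changed. -/

/-- Real part of the pairing of two dilates is continuous at `η = 0` (corollary of `continuousAt_pairing_weilDilate`; the form in
which part 2/2 `HandoffPoleFreeClosed.lean` consumes it). [folklore] -/
theorem continuousAt_re_pairing_weilDilate (hu : IsWeilTest u) (hv : IsWeilTest v) :
    ContinuousAt (fun η : ℝ ↦ (weilFunctional (weilConv (weilDilate η u) (weilReflect (weilDilate η v)))).re) 0 :=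
  Complex.continuous_re.continuousAt.comp (continuousAt_pairing_weilDilate hu hv)

end Summit.RiemannHypothesis.RiemannHypothesis.Theorems.HandoffPoleFree
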